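import Literature.RingTheory.Nullstellensatz.EffectiveNullstellensatz
import Mathlib.LinearAlgebra.Dimension.Finite
import Mathlib.FieldTheory.IsAlgClosed.Basic
import HarnessLib

/-!
# Univariate polynomials in an ideal with few values of a coordinate (the resolvent trick)

Topic `Literature/RingTheory/Nullstellensatz`. Let `S_1, …, S_s ∈ ℚ[Y_1, …, Y_n]` have degree
`≤ d` (`d ≥ 1`) and suppose the `j`-th coordinates of the complex zeros of `S` take at most `N`
values. Then **there is a nonzero univariate `q ∈ ℚ[T]` of degree `≤ D = (E+1)^n`,
`E = effNSBound n d`, with `q(Y_j) = ∑ G_i S_i`, `deg G_i ≤ D + E`**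
(`exists_univariate_mem_idealUpTo`). Proof ("resolvent trick", avoiding both Rabinowitsch's
variable and any dimension theory): for each of `D + 1` natural numbers `a_t ≤ N + D` that are not
`j`-th coordinates of zeros, the fibre `Y_j = a_t` is empty, so the effective Nullstellensatz over
`ℚ ⊆ ℂ` (`exists_sum_mul_eq_one_of_forall_exists_ne_zero`) gives
`1 = ∑_i g_i^{(t)} S_i + c_t (Y_j - a_t)` with `deg ≤ E`; the `D + 1` polynomials `c_t` of degree
`≤ E` are linearly dependent, `∑ μ_t c_t = 0`, and then
`q(T) = ∑_t μ_t ∏_{t' ≠ t} (T - a_{t'})` works: multiplying the `t`-th identity by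
`μ_t ∏_{t' ≠ t}(Y_j - a_{t'})` and summing, the terms `c_t ∏_{t'} (Y_j - a_{t'})` add up to zero,
and `q(a_t) = μ_t ∏_{t' ≠ t} (a_t - a_{t'}) ≠ 0` for `μ_t ≠ 0`. This is the zero-dimensional
elimination step of an elementary proof of the existence of algebraic points of small degree and
height (Bürgisser 2000 TCS, Thm. 4.5, there via Krick–Pardo's geometric resolution).

## Contents (namespace `Literature.RingTheory.Nullstellensatz`, everything proved)

* `elimDegBound` — `D = (effNSBound n d + 1)^n`;
* `exists_univariate_mem_idealUpTo` — the statement above.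
-/

noncomputable section

open MvPolynomial Module
open scoped Classical

namespace Literature.RingTheory.Nullstellensatz

/-- The degree bound `D = (E + 1)^n` of the univariate eliminant. [folklore] -/
def elimDegBound (n d : ℕ) : ℕ := (effNSBound n d + 1) ^ n

/-- `dim ℚ[Y]_{≤ E} ≤ (E+1)^n`. [folklore] -/
theorem finrank_restrictTotalDegree_le (k : Type*) [Field k] (n m : ℕ) :
    finrank k ↥(restrictTotalDegree (Fin n) k m) ≤ (m + 1) ^ n := by
  calc finrank k ↥(restrictTotalDegree (Fin n) k m)
      ≤ finrank k ↥(restrictDegree (Fin n) k m) :=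
        Submodule.finrank_mono (restrictTotalDegree_le_restrictDegree _ _ _)
    _ = (m + 1) ^ n := by rw [finrank_restrictDegree, Fintype.card_fin]

/-- There are `D + 1` distinct natural numbers `≤ N + D` avoiding a set of at most `N` complex
numbers. [folklore] -/
theorem exists_nat_avoiding {K : Type*} [Field K] [CharZero K] (T : Finset K) {N D : ℕ}
    (hT : T.card ≤ N) :
    ∃ a : Fin (D + 1) → ℕ, Function.Injective a ∧ (∀ t, a t ≤ N + D) ∧ ∀ t, ((a t : ℕ) : K) ∉ T := by
  set A : Finset ℕ := (Finset.range (N + D + 1)).filter fun a => ((a : ℕ) : K) ∉ T with hA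
  have hcard : D + 1 ≤ A.card := by
    have h1 : ((Finset.range (N + D + 1)).filter fun a => ((a : ℕ) : K) ∈ T).card ≤ T.card := by
      refine Finset.card_le_card_of_injOn (fun a : ℕ => (a : K)) (fun a ha => ?_) ?_
      · exact (Finset.mem_filter.1 (Finset.mem_coe.1 ha)).2
      · intro a _ b _ h
        dsimp only at h
        exact_mod_cast h
    have h2 := Finset.card_filter_add_card_filter_not
      (s := Finset.range (N + D + 1)) (fun a => ((a : ℕ) : K) ∈ T)
    rw [Finset.card_range] at h2
    have h3 : ((Finset.range (N + D + 1)).filter fun a => ¬ ((a : ℕ) : K) ∈ T) = A := by rw [hA]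
    rw [h3] at h2
    omega
  obtain ⟨B, hBA, hBcard⟩ := Finset.exists_subset_card_eq hcard
  let e : Fin (D + 1) ≃ B := (Finset.equivFinOfCardEq hBcard).symm
  refine ⟨fun t => (e t : ℕ), fun t t' h => e.injective (Subtype.ext h), fun t => ?_, fun t => ?_⟩
  · have hm : ((e t : ℕ)) ∈ A := hBA (e t).2
    have := (Finset.mem_filter.1 hm).1
    rw [Finset.mem_range] at this
    change ((e t : ℕ)) ≤ N + D
    omega
  · have hm : ((e t : ℕ)) ∈ A := hBA (e t).2
    exact (Finset.mem_filter.1 hm).2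

/-- **A univariate polynomial in the ideal, from few values of a coordinate** (resolvent trick;
see the module docstring). For `S_i ∈ ℚ[Y_1, …, Y_n]` of degree `≤ d` (`d ≥ 1`) whose complex
zeros have `j`-th coordinates in a set of at most `N` elements, there is `0 ≠ q ∈ ℚ[T]`,
`deg q ≤ D = elimDegBound n d`, with `q(Y_j) ∈ (S)_{≤ D + E}`, `E = effNSBound n d`. [folklore] -/
theorem exists_univariate_mem_idealUpTo {K : Type*} [Field K] [CharZero K] [Algebra ℚ K] [IsAlgClosed K]
    {n s d : ℕ} (S : Fin s → MvPolynomial (Fin n) ℚ)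
    (hd : ∀ i, (S i).totalDegree ≤ d) (hd1 : 1 ≤ d) (j : Fin n) {N : ℕ} (T : Finset K)
    (hT : T.card ≤ N)
    (hproj : ∀ x : Fin n → K, (∀ i, aeval x (S i) = 0) → x j ∈ T) :
    ∃ q : Polynomial ℚ, q ≠ 0 ∧ q.natDegree ≤ elimDegBound n d ∧
      (Polynomial.aeval (X j : MvPolynomial (Fin n) ℚ) q) ∈
        idealUpTo S (elimDegBound n d + effNSBound n d) := by
  set E := effNSBound n d with hE
  set D := elimDegBound n d with hD
  -- good parameters
  obtain ⟨a, hainj, -, haT⟩ := exists_nat_avoiding (D := D) T hT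
  -- the effective Nullstellensatz on each empty fibre
  have hfib : ∀ t : Fin (D + 1), ∃ g : Fin s → MvPolynomial (Fin n) ℚ, ∃ c : MvPolynomial (Fin n) ℚ,
      (∀ i, (g i).totalDegree ≤ E) ∧ c.totalDegree ≤ E ∧
      ∑ i, g i * S i + c * (X j - C ((a t : ℕ) : ℚ)) = 1 := by
    intro t
    set S' : Fin (s + 1) → MvPolynomial (Fin n) ℚ := Fin.snoc S (X j - C ((a t : ℕ) : ℚ)) with hS'
    have hd' : ∀ i, (S' i).totalDegree ≤ d := by
      intro i
      refine Fin.lastCases ?_ (fun i => ?_) i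
      · rw [hS', Fin.snoc_last]
        refine (totalDegree_sub _ _).trans (max_le ?_ ?_)
        · rw [totalDegree_X]; exact hd1
        · rw [totalDegree_C]; exact Nat.zero_le _
      · rw [hS', Fin.snoc_castSucc]; exact hd i
    have hV : ∀ x : Fin n → K, ∃ i, aeval x (S' i) ≠ 0 := by
      intro x
      by_contra h
      push Not at h
      have hx : ∀ i, aeval x (S i) = 0 := fun i => by
        have := h i.castSucc
        rwa [hS', Fin.snoc_castSucc] at this
      have hxa : x j = ((a t : ℕ) : K) := by
        have := h (Fin.last s)
        rw [hS', Fin.snoc_last, map_sub, aeval_X, aeval_C, sub_eq_zero] at this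
        rw [this]; simp
      exact haT t (hxa ▸ hproj x hx)
    obtain ⟨g, hg1, hgdeg⟩ := exists_sum_mul_eq_one_of_forall_exists_ne_zero (K := K) S' hd' hV
    refine ⟨fun i => g i.castSucc, g (Fin.last s), fun i => hgdeg _, hgdeg _, ?_⟩
    rw [← hg1, Fin.sum_univ_castSucc, hS']
    simp only [Fin.snoc_castSucc, Fin.snoc_last]
  choose g c hgdeg hcdeg heq using hfib
  -- the `c_t` are dependent
  set W := restrictTotalDegree (Fin n) ℚ E with hW
  let cW : Fin (D + 1) → W := fun t => ⟨c t, (mem_restrictTotalDegree _ _ _).2 (hcdeg t)⟩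
  have hdep : ¬ LinearIndependent ℚ cW := by
    intro hli
    have h := hli.fintype_card_le_finrank
    rw [Fintype.card_fin] at h
    have h2 : finrank ℚ W ≤ D := by rw [hD, elimDegBound, hW]; exact finrank_restrictTotalDegree_le ℚ n E
    omega
  obtain ⟨μ, hμ, t₀, ht₀⟩ := Fintype.not_linearIndependent_iff.1 hdep
  have hμc : ∑ t, μ t • c t = 0 := by
    have := congrArg (fun w : W => (w : MvPolynomial (Fin n) ℚ)) hμ
    simpa [cW] using this
  -- the resolvent polynomial
  set q : Polynomial ℚ :=
    ∑ t, Polynomial.C (μ t) * ∏ t' ∈ Finset.univ.erase t, (Polynomial.X - Polynomial.C ((a t' : ℕ) : ℚ))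
    with hq
  refine ⟨q, ?_, ?_, ?_⟩
  · -- `q (a t₀) ≠ 0`
    intro hq0
    have h := congrArg (Polynomial.eval ((a t₀ : ℕ) : ℚ)) hq0
    rw [Polynomial.eval_zero, hq, Polynomial.eval_finsetSum,
      Finset.sum_eq_single_of_mem t₀ (Finset.mem_univ _)] at h
    · rw [Polynomial.eval_mul, Polynomial.eval_C, Polynomial.eval_prod] at h
      refine mul_ne_zero ht₀ (Finset.prod_ne_zero_iff.2 fun t' ht' => ?_) h
      rw [Polynomial.eval_sub, Polynomial.eval_X, Polynomial.eval_C, sub_ne_zero]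
      intro h'
      exact (Finset.mem_erase.1 ht').1 (hainj (by exact_mod_cast h'.symm))
    · intro t _ hne
      rw [Polynomial.eval_mul, Polynomial.eval_prod,
        Finset.prod_eq_zero (Finset.mem_erase.2 ⟨Ne.symm hne, Finset.mem_univ _⟩), mul_zero]
      rw [Polynomial.eval_sub, Polynomial.eval_X, Polynomial.eval_C, sub_self]
  · -- degree
    rw [hq]
    refine (Polynomial.natDegree_sum_le_of_forall_le _ _ fun t _ => ?_)
    refine (Polynomial.natDegree_C_mul_le _ _).trans ?_
    refine (Polynomial.natDegree_prod_le _ _).trans ?_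
    refine (Finset.sum_le_sum fun t' _ =>
      (Polynomial.natDegree_X_sub_C ((a t' : ℕ) : ℚ)).le).trans ?_
    rw [Finset.sum_const, smul_eq_mul, mul_one, Finset.card_erase_of_mem (Finset.mem_univ _),
      Finset.card_univ, Fintype.card_fin]
    omega
  · -- membership: `q(Y_j) = ∑_i G_i S_i`
    set Pe : Fin (D + 1) → MvPolynomial (Fin n) ℚ :=
      fun t => ∏ t' ∈ Finset.univ.erase t, (X j - C ((a t' : ℕ) : ℚ)) with hPe
    have hlin : ∀ t', (X j - C ((a t' : ℕ) : ℚ) : MvPolynomial (Fin n) ℚ).totalDegree ≤ 1 := fun t' =>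
      (totalDegree_sub _ _).trans (max_le (by rw [totalDegree_X]) (by rw [totalDegree_C]; omega))
    have hPedeg : ∀ t, (Pe t).totalDegree ≤ D := by
      intro t
      refine (totalDegree_finsetProd _ _).trans ?_
      refine (Finset.sum_le_sum fun t' _ => hlin t').trans ?_
      rw [Finset.sum_const, smul_eq_mul, mul_one, Finset.card_erase_of_mem (Finset.mem_univ _),
        Finset.card_univ, Fintype.card_fin]
      omega
    have haeval : Polynomial.aeval (X j : MvPolynomial (Fin n) ℚ) q = ∑ t, μ t • Pe t := by
      rw [hq, map_sum]
      refine Finset.sum_congr rfl fun t _ => ?_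
      rw [map_mul, Polynomial.aeval_C, MvPolynomial.algebraMap_eq, map_prod, smul_eq_C_mul]
      congr 1
      exact Finset.prod_congr rfl fun t' _ => by simp
    -- the product over all `t'`
    set Pall : MvPolynomial (Fin n) ℚ := ∏ t', (X j - C ((a t' : ℕ) : ℚ)) with hPall
    have hsplit : ∀ t, Pe t * (X j - C ((a t : ℕ) : ℚ)) = Pall := fun t =>
      Finset.prod_erase_mul _ _ (Finset.mem_univ t)
    -- the identity
    have hmain : ∑ t, μ t • Pe t = ∑ i, (∑ t, μ t • (Pe t * g t i)) * S i := by
      have step : ∀ t, μ t • Pe t = (∑ i, μ t • (Pe t * g t i) * S i) + μ t • (Pall * c t) := by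
        intro t
        calc μ t • Pe t = μ t • (Pe t * 1) := by rw [mul_one]
          _ = μ t • (Pe t * (∑ i, g t i * S i + c t * (X j - C ((a t : ℕ) : ℚ)))) := by rw [heq t]
          _ = (∑ i, μ t • (Pe t * g t i) * S i) + μ t • (Pall * c t) := by
              rw [← hsplit t, mul_add, Finset.mul_sum, smul_add, Finset.smul_sum]
              congr 1
              · exact Finset.sum_congr rfl fun i _ => by rw [← mul_assoc, smul_mul_assoc]
              · congr 1; ring
      rw [Finset.sum_congr rfl fun t _ => step t, Finset.sum_add_distrib]
      have hzero : ∑ t, μ t • (Pall * c t) = 0 := by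
        calc ∑ t, μ t • (Pall * c t) = Pall * ∑ t, μ t • c t := by
              rw [Finset.mul_sum]
              exact Finset.sum_congr rfl fun t _ => by rw [mul_smul_comm]
          _ = 0 := by rw [hμc, mul_zero]
      rw [hzero, add_zero, Finset.sum_comm]
      refine Finset.sum_congr rfl fun i _ => ?_
      rw [Finset.sum_mul]
    rw [haeval, hmain]
    refine mem_idealUpTo_iff.2 ⟨fun i => ∑ t, μ t • (Pe t * g t i), fun i => ?_, rfl⟩
    refine totalDegree_finsetSum_le fun t _ => ?_
    refine (totalDegree_smul_le _ _).trans ((totalDegree_mul _ _).trans ?_)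
    exact add_le_add (hPedeg t) (hgdeg t i)

end Literature.RingTheory.Nullstellensatz

end
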